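import Literature.NumberTheory.LFunctions.Zhang2022.MainTermFormCSEquality

/-!
# One-sided profiles: the margin-zero locus of `𝔅` collapses to the parallel ray

Companion to `MainTermFormCSEquality` and `Section2SecondOrder` (repair cell `pub-zhang`, audit +
repair census of Y. Zhang, *Discrete mean estimates and the Landau–Siegel zero*, arXiv:2211.02515v1
(2022) [Zhang2022LandauSiegel]; the cell's verdict on that manuscript is NEGATIVE — the printed
inequality (8.24) fails, `Zhang2022.not_ineq824` — and **this file makes no claim about its
Theorems 1–2 and no claim about Landau–Siegel zeros**).

`MainTermFormCSEquality.norm_sq_mainTermFormPolar_eq_mul_iff_eqOn` locates the equality case of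
Cauchy–Schwarz for the glued main-term form `𝔅` on `H¹` profiles: for `𝔅(u,u) > 0`,
`|P(u,f)|² = 𝔅(u,u)𝔅(f,f)` iff `f ∈ ℂu + AFE` on `[0,1]`, `AFE = span{e^{−iπy}, e^{−2iπy},
e^{−3iπy}}`. A ONE-SIDED design of the cell's admissible class (`H₂ = 0`, every mollifier length
`θ < 1`) has a glued profile `u` supported in `[0,θ]`, and the `J`-profile `f` is supported in
`[0, 0.504]`; both vanish on `[θ′,1]` for some `θ′ < 1`. This file proves that for such profiles
the AFE part of the locus is invisible:

* `afeComb_coeff_eq_zero_of_eventually`, `afeComb_coeff_eq_zero_of_eqOn_Icc` — a combination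
  `a e^{−iπy} + b e^{−2iπy} + c e^{−3iπy}` vanishing near a point (in particular on `[θ,1]`,
  `θ < 1`) has `a = b = c = 0` (evaluate it and its first two derivatives: a Vandermonde system in
  the frequencies `−iπ, −2iπ, −3iπ`).
* **`eqOn_smul_of_eqOn_afeComb_of_oneSided`** — if `u`, `f` vanish on `[θ,1]` (`θ < 1`) and
  `f = t·u + (AFE combination)` on `[0,1]`, then `f = t·u` on `[0,1]`.
* **`exists_eqOn_smul_of_margin_zero_of_oneSided`** — hence for one-sided `H¹` profiles with
  `𝔅(u,u) > 0`: `|P(u,f)|² = 𝔅(u,u)𝔅(f,f)` only if `f = t·u` on `[0,1]` (the PARALLEL ray);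
  `norm_sq_mainTermFormPolar_lt_mul_of_oneSided` — strict Cauchy–Schwarz for every other
  one-sided pair; `lt_sqrt_of_mainTerm_thresholds_of_oneSided` — the §2 shape: off the parallel
  ray a one-sided design misses the closing condition `√(q·c_J) < d` by a POSITIVE main-order
  margin.

Census reading (ALT-2.md §10, cell V12 (a) / row V18): on the parallel ray the profiles of `H₁`
and `t·J₁` coincide, so `H₁ = tJ₁` as Dirichlet polynomials and `Section2SecondOrder` (parallel
designs: (2.18) and Cauchy–Schwarz hold with equality, `not_exists_scale_of_closing`) applies;
off it the main-order margin is positive. So no one-sided admissible design is left undecided by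
main-order information plus exact algebra: census cell V12 (a) is confined to TWO-SIDED
margin-zero designs. All declarations are elementary and tagged `[folklore]`.
-/

noncomputable section

open Set Filter
open scoped Real ComplexConjugate Topology

namespace Literature.NumberTheory.LFunctions.Zhang2022

variable {u u' f f' : ℝ → ℂ}

/-! ### AFE combinations vanishing on an interval are trivial -/

/-- The derivative of an AFE combination is the AFE combination with coefficients
`a c₁, b c₂, c c₃`. [folklore] -/
theorem hasDerivAt_afeComb (a b c : ℂ) (y : ℝ) :
    HasDerivAt (fun y => a * afeDir 1 y + b * afeDir 2 y + c * afeDir 3 y)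
      (a * afeFreq 1 * afeDir 1 y + b * afeFreq 2 * afeDir 2 y + c * afeFreq 3 * afeDir 3 y) y :=
  ((((hasDerivAt_afeDir 1 y).const_mul a).add ((hasDerivAt_afeDir 2 y).const_mul b)).add
    ((hasDerivAt_afeDir 3 y).const_mul c)).congr_deriv (by simp only [afeDir']; ring)

/-- If an AFE combination vanishes near `y₀`, so does its derivative combination. [folklore] -/
theorem afeComb_deriv_eventually_zero {a b c : ℂ} {y₀ : ℝ}
    (h : ∀ᶠ y in 𝓝 y₀, a * afeDir 1 y + b * afeDir 2 y + c * afeDir 3 y = 0) :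
    ∀ᶠ y in 𝓝 y₀,
      a * afeFreq 1 * afeDir 1 y + b * afeFreq 2 * afeDir 2 y + c * afeFreq 3 * afeDir 3 y = 0 := by
  filter_upwards [h.eventually_nhds] with y hy
  exact (hasDerivAt_afeComb a b c y).unique ((hasDerivAt_const y (0:ℂ)).congr_of_eventuallyEq hy)

/-- `c_2 = 2c_1`. [folklore] -/
theorem afeFreq_two : afeFreq 2 = 2 * afeFreq 1 := by
  unfold afeFreq; push_cast; ring

/-- `c_3 = 3c_1`. [folklore] -/
theorem afeFreq_three : afeFreq 3 = 3 * afeFreq 1 := by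
  unfold afeFreq; push_cast; ring

/-- `k_j(y) ≠ 0`. [folklore] -/
theorem afeDir_ne_zero (j : ℕ) (y : ℝ) : afeDir j y ≠ 0 := fun h => by
  simpa [h] using norm_afeDir j y

/-- **An AFE combination vanishing near a point is trivial**: if
`a e^{−iπy} + b e^{−2iπy} + c e^{−3iπy} = 0` for all `y` near `y₀` then `a = b = c = 0` (the
combination and its first two derivatives vanish at `y₀`: a Vandermonde system in the distinct
frequencies `−iπ, −2iπ, −3iπ`). [folklore] -/
theorem afeComb_coeff_eq_zero_of_eventually {a b c : ℂ} {y₀ : ℝ}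
    (h : ∀ᶠ y in 𝓝 y₀, a * afeDir 1 y + b * afeDir 2 y + c * afeDir 3 y = 0) :
    a = 0 ∧ b = 0 ∧ c = 0 := by
  have h1 := afeComb_deriv_eventually_zero h
  have h2 := afeComb_deriv_eventually_zero h1
  have e0 := h.self_of_nhds
  have e1 := h1.self_of_nhds
  have e2 := h2.self_of_nhds
  rw [afeFreq_two, afeFreq_three] at e1 e2
  have hf : afeFreq 1 ≠ 0 := afeFreq_ne_zero one_ne_zero
  have l1 : a * afeDir 1 y₀ + 2 * (b * afeDir 2 y₀) + 3 * (c * afeDir 3 y₀) = 0 := by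
    have h' : afeFreq 1 * (a * afeDir 1 y₀ + 2 * (b * afeDir 2 y₀) + 3 * (c * afeDir 3 y₀))
        = 0 := by
      linear_combination e1
    exact (mul_eq_zero.mp h').resolve_left hf
  have l2 : a * afeDir 1 y₀ + 4 * (b * afeDir 2 y₀) + 9 * (c * afeDir 3 y₀) = 0 := by
    have h' : afeFreq 1 ^ 2 * (a * afeDir 1 y₀ + 4 * (b * afeDir 2 y₀) + 9 * (c * afeDir 3 y₀))
        = 0 := by
      linear_combination e2
    exact (mul_eq_zero.mp h').resolve_left (pow_ne_zero 2 hf)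
  have u3 : c * afeDir 3 y₀ = 0 := by
    linear_combination e0 - (3/2 : ℂ) * l1 + (1/2 : ℂ) * l2
  have u2 : b * afeDir 2 y₀ = 0 := by linear_combination l1 - e0 - 2 * u3
  have u1 : a * afeDir 1 y₀ = 0 := by linear_combination e0 - u2 - u3
  exact ⟨(mul_eq_zero.mp u1).resolve_right (afeDir_ne_zero 1 y₀),
    (mul_eq_zero.mp u2).resolve_right (afeDir_ne_zero 2 y₀),
    (mul_eq_zero.mp u3).resolve_right (afeDir_ne_zero 3 y₀)⟩

/-- **AFE combinations vanishing on `[θ,1]`, `θ < 1`, are trivial.** [folklore] -/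
theorem afeComb_coeff_eq_zero_of_eqOn_Icc {a b c : ℂ} {θ : ℝ} (hθ : θ < 1)
    (h : ∀ y ∈ Icc θ 1, a * afeDir 1 y + b * afeDir 2 y + c * afeDir 3 y = 0) :
    a = 0 ∧ b = 0 ∧ c = 0 :=
  afeComb_coeff_eq_zero_of_eventually (y₀ := (θ + 1) / 2)
    (Filter.eventually_of_mem (Icc_mem_nhds (by linarith) (by linarith)) h)

/-! ### One-sided profiles -/

/-- **The AFE part of the locus is invisible to one-sided profiles.** If `u` and `f` vanish on
`[θ,1]` for some `θ < 1` and `f = t·u + a e^{−iπy} + b e^{−2iπy} + c e^{−3iπy}` on `[0,1]`, then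
`a = b = c = 0` and `f = t·u` on `[0,1]`. [folklore] -/
theorem eqOn_smul_of_eqOn_afeComb_of_oneSided {θ : ℝ} (hθ : θ < 1)
    (hu0 : ∀ y ∈ Icc θ 1, u y = 0) (hf0 : ∀ y ∈ Icc θ 1, f y = 0) {t a b c : ℂ}
    (h : EqOn f (fun y => t * u y + a * afeDir 1 y + b * afeDir 2 y + c * afeDir 3 y) (Icc 0 1)) :
    EqOn f (fun y => t * u y) (Icc 0 1) := by
  have hm : max θ 0 < 1 := max_lt hθ one_pos
  have hE : ∀ y ∈ Icc (max θ 0) 1, a * afeDir 1 y + b * afeDir 2 y + c * afeDir 3 y = 0 := by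
    intro y hy
    have hyθ : y ∈ Icc θ 1 := ⟨(le_max_left _ _).trans hy.1, hy.2⟩
    have hy0 : y ∈ Icc (0:ℝ) 1 := ⟨(le_max_right _ _).trans hy.1, hy.2⟩
    have := h hy0
    simp only at this
    rw [hf0 y hyθ, hu0 y hyθ, mul_zero, zero_add] at this
    exact this.symm
  obtain ⟨ha, hb, hc⟩ := afeComb_coeff_eq_zero_of_eqOn_Icc hm hE
  intro y hy
  have := h hy
  simp only [ha, hb, hc, zero_mul, add_zero] at this
  exact this

/-- **One-sided designs: main-order margin zero only on the parallel ray.** For `H¹` profiles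
`u, f` with `𝔅(u,u) > 0` which both vanish on `[θ,1]` for some `θ < 1`: if
`|P(u,f)|² = 𝔅(u,u)·𝔅(f,f)` then `f = t·u` on `[0,1]` for some `t ∈ ℂ`. [folklore] -/
theorem exists_eqOn_smul_of_margin_zero_of_oneSided (hu : IsH1OnUnitInterval u u')
    (hf : IsH1OnUnitInterval f f') (hpos : 0 < mainTermForm u u') {θ : ℝ} (hθ : θ < 1)
    (hu0 : ∀ y ∈ Icc θ 1, u y = 0) (hf0 : ∀ y ∈ Icc θ 1, f y = 0)
    (heq : ‖mainTermFormPolar u u' f f'‖ ^ 2 = mainTermForm u u' * mainTermForm f f') :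
    ∃ t : ℂ, EqOn f (fun y => t * u y) (Icc 0 1) := by
  obtain ⟨t, a, b, c, h⟩ := (norm_sq_mainTermFormPolar_eq_mul_iff_eqOn hu hf hpos).mp heq
  exact ⟨t, eqOn_smul_of_eqOn_afeComb_of_oneSided hθ hu0 hf0 h⟩

/-- **Strict Cauchy–Schwarz for one-sided pairs off the parallel ray.** [folklore] -/
theorem norm_sq_mainTermFormPolar_lt_mul_of_oneSided (hu : IsH1OnUnitInterval u u')
    (hf : IsH1OnUnitInterval f f') (hpos : 0 < mainTermForm u u') {θ : ℝ} (hθ : θ < 1)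
    (hu0 : ∀ y ∈ Icc θ 1, u y = 0) (hf0 : ∀ y ∈ Icc θ 1, f y = 0)
    (hnot : ¬ ∃ t : ℂ, EqOn f (fun y => t * u y) (Icc 0 1)) :
    ‖mainTermFormPolar u u' f f'‖ ^ 2 < mainTermForm u u' * mainTermForm f f' :=
  lt_of_le_of_ne (norm_sq_mainTermFormPolar_le hu hf) fun heq =>
    hnot (exists_eqOn_smul_of_margin_zero_of_oneSided hu hf hpos hθ hu0 hf0 heq)

/-- **The §2 shape for one-sided designs.** If `𝔅(𝔤,𝔤) ≤ q`, `𝔅(f,f) ≤ c_J`, `d ≤ |P(𝔤,f)|`,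
`𝔅(𝔤,𝔤) > 0`, `𝔤` and `f` vanish on `[θ,1]` (`θ < 1`) and `f ∉ ℂ𝔤` on `[0,1]`, then
`d < √(q·c_J)`: the closing condition `√(q·c_J) < d` of
`Section2Assembly.EndgameData.false_of_closing` misses by a positive main-order margin. (On the
parallel ray `f = t𝔤` it misses by exactly `0` at main order, and there `Section2SecondOrder`
shows the skeleton degenerates.) [folklore] -/
theorem lt_sqrt_of_mainTerm_thresholds_of_oneSided (hg : IsH1OnUnitInterval u u')
    (hf : IsH1OnUnitInterval f f') (hpos : 0 < mainTermForm u u') {θ : ℝ} (hθ : θ < 1)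
    (hu0 : ∀ y ∈ Icc θ 1, u y = 0) (hf0 : ∀ y ∈ Icc θ 1, f y = 0)
    (hnot : ¬ ∃ t : ℂ, EqOn f (fun y => t * u y) (Icc 0 1))
    {q cJ d : ℝ} (hq : mainTermForm u u' ≤ q) (hcJ : mainTermForm f f' ≤ cJ)
    (hd : d ≤ ‖mainTermFormPolar u u' f f'‖) : d < Real.sqrt (q * cJ) := by
  refine lt_sqrt_of_mainTerm_thresholds_of_not_eqOn hg hf hpos ?_ hq hcJ hd
  rintro ⟨t, a, b, c, h⟩
  exact hnot ⟨t, eqOn_smul_of_eqOn_afeComb_of_oneSided hθ hu0 hf0 h⟩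

end Literature.NumberTheory.LFunctions.Zhang2022
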